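import Literature.NumberTheory.LFunctions.BurnolLPropertyProofs
import Literature.NumberTheory.LFunctions.BurnolSonineChainDensityProofs
import Literature.NumberTheory.ConnesConsani2021.ScalingOperator
import Literature.Analysis.Fourier.L2FourierDilation
import Mathlib.Analysis.Calculus.BumpFunction.Normed
import Mathlib.Analysis.Calculus.ParametricIntegral
import Mathlib.MeasureTheory.Integral.IntegralEqImproper
import HarnessLib

/-!
# Burnol 2004b, Thm. 4.9: the subspace `𝓛₁` is dense in `L_1` (proof)

LINE 1 — LABEL: RH-FREE (an `L²` density lemma for Burnol's extended Sonine space `L_1`; the Riemann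
zeta function does not occur — `L_1` is the space of even `L²` functions constant on `(0,1)` together
with their cosine transform). FRAMING (cell rh-crit, D-0074): corpus theorems are RH-FREE literature;
nothing here is worded as progress toward RH. bears_on: B-C/B-P (LADDER-RH COLUMN 6, de Branges
framework) — Thm. 4.9 feeds [Burnol2004b] Thm. 5.2 / Cor. 5.3 (completeness of `ζ(s)/(s−ρ)` in `L̂_1`).
WHAT THIS IS NOT: not a route, not a criterion, no positivity at `E_ζ`; discharging an as-printed
structural theorem of an RH-criterion corpus fixes corpus vocabulary and moves RH by nothing. Nothing
here bears on the truth of RH.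

Source. J.-F. Burnol, *Two complete and minimal systems associated with the zeros of the Riemann zeta
function*, J. Théor. Nombres Bordeaux **16** (2004) 65–94 = arXiv:math/0203120v7 [Burnol2004b], §4,
Definition of `𝓛₁` and Thm. 4.9 (TeX of record `rh-crit/dbl/src/Burnol2004JTNB_arXivmath0203120v7.tex`
l.899–944):

> **Definition.** We let `𝓛₁` be the sub-vector space of `L_1` containing the functions `g(t)` whose
> right Mellin transforms `G(s)` are `O_{g,a,b,N}(|s|^{−N})` on all vertical strips `a ≤ Re(s) ≤ b`, and
> for all integers `N ≥ 1` (away from the pole).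
> **Theorem 4.9.** The sub-vector space `𝓛₁` is dense in `L_1`.

Printed proof (TeX l.911–944): "From proposition [4.6] we only have to show that any function `G(s)` in
a `L̂_b`, `b > 1` is in the closure of `𝓛̂₁`. For this let `θ(s)` be the Mellin transform of a smooth
function with support in `[1/e, e]`, satisfying `θ(1/2) = 1` … `G_ε(s) = θ(ε(s−1/2)+1/2)G(s)` … converge
in `L²`-norm to `G(s)`. We prove that for `1 ≤ exp(−ε)b < b` these functions all belong to `𝓛₁`. Their
quick decrease in vertical strips is guaranteed by the fact that `G(s)` has the L-Property. The
function `((s−1)/s)G_ε(s)` … on the critical line is the Mellin transform of a multiplicative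
convolution on `(0,∞)` of an element in `L²(b,∞)` with a smooth function supported in
`[exp(−ε), exp(+ε)]`. The support of this multiplicative convolution will be included in `[1,∞)` if
`1 ≤ exp(−ε)b` … Its image under `𝓕₊` is `θ(−ε(s−1/2)+1/2)𝓕₊(G)(s)` …".

## What is PROVED (theorem-only module; no definition of `Prop` type, no new named fact; net debt −1)

* `Burnol2004b_thm4_9_holds : Burnol2004b_thm4_9` — the DISCHARGE of the named fact of
  `BurnolZetaSystemsHardy.lean` (`sonineL 1 ⊆ closure burnolScriptL1`).
* Reusable pieces (namespace `BurnolScriptL1Density`; the module declares NO definitions, every object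
  is written out): the Mellin multiplier `Θ_w(s) = ∫ w(τ)e^{τ(1/2−s)}dτ` of a weight `w` (entire:
  `differentiable_mollMultiplier`;
  integration by parts `mollMultiplier_eq_deriv` / `mollMultiplier_eq_iterate_deriv`; rapid decay in
  vertical strips `norm_mollMultiplier_le_pow`); the multiplicative mollifier `ϑ(w)g = scalingOp w g`
  (Connes–Consani's integrated unitary scaling `∫ w(τ)ϑ(e^τ)g dτ` of `ScalingOperator.lean`) on
  functions constant near `0⁺` (`scalingOp_ae_const_Ioo`), on even functions (`scalingOp_mem_evenPart`),
  under the `L²` Fourier transform (`fourier_scalingUnitary`, `fourier_scalingOp`), under the right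
  Mellin transform on the strip (`rightMellin_scalingUnitary`, `rightMellin_scalingOp`), and as an
  approximate identity (`norm_scalingOp_sub_le`); `exists_pow_bound_of_hasLProperty` (L-Property +
  holomorphy off `1` ⇒ polynomial bound on whole strips, `|Im s| ≥ 1`);
  `scalingOp_mem_sonineL_one`, `scalingOp_mem_burnolScriptL1` (`ϑ(ψ)g ∈ 𝓛₁` for `g ∈ L_b`, `b > 1`,
  `ψ` smooth supported in `[−log b, log b]`).

## How the printed proof is followed (tree inputs)

* "From proposition 4.6": `Burnol2004b_prop4_6_holds` (⋃_{b>1} L_b dense in `L_1`).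
* The mollifier: additive avatar `τ = log u` of Burnol's multiplicative convolution, i.e. the Bochner
  integral `∫ ψ_ε(τ) ϑ(e^τ)g dτ` in `L²(ℝ)` with the tree's unitary scaling
  `(ϑ(e^τ)g)(v) = e^{−τ/2}g(e^{−τ}v)` (`Literature.NumberTheory.ConnesConsani2021.scalingOp`); its Mellin
  multiplier `Θ(s) = ∫ψ_ε(τ)e^{τ(1/2−s)}dτ` IS Burnol's `θ(ε(s−1/2)+1/2)` (the unitary normalisation of `ϑ`
  produces the shift by `1/2`). `ψ_ε` is a Mathlib `ContDiffBump` (normed, support `(−ε, ε)`).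
* "they … converge in `L²`-norm": strong continuity of `τ ↦ ϑ(e^τ)g`
  (`continuous_scalingUnitary_apply`) — the function-side form of the dominated convergence on the
  critical line used in print.
* "all belong to `𝓛₁`" — membership in `L_1`: DEVIATION (declared, immaterial): print certifies
  `G_ε ∈ L̂_1` through the `ℍ²`-characterisation of Prop. 4.1 (`G_ε`, `𝓕₊(G_ε) ∈ (s/(s−1))ℍ²`); the typed
  `Burnol2004b_prop4_1` is refuted in the tree, so we prove the SAME support statement directly on the
  function side: `ϑ(ψ_ε)g` is constant on `(0,1)` when `e^{ε} ≤ b` (`scalingOp_ae_const_Ioo`), and so is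
  its Fourier transform because `𝓕(ϑ(e^τ)g) = ϑ(e^{−τ})𝓕g` (`fourier_scalingUnitary`, the tree's `L²`
  dilation law `Literature.Analysis.Fourier.fourier_comp_mul_left_ae_eq`) — this is exactly print's
  "its image under `𝓕₊` is `θ(−ε(s−1/2)+1/2)𝓕₊(G)`".
* "quick decrease … guaranteed by the L-Property": `Burnol2004b_thm4_8_holds` (dbl-iso,
  `BurnolLPropertyProofs.lean`) + compactness below the height `T₀` (`exists_pow_bound_of_hasLProperty`),
  times the decay `‖Θ(s)‖ ≤ e^{R|1/2−Re s|}‖ψ^{(N)}‖₁|Im s|^{−N}` from `N` integrations by parts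
  (Mathlib `integral_mul_deriv_eq_deriv_mul_of_integrable`); the identity
  `(ϑ(ψ)g)^ = Θ · G_g` on `ℂ ∖ {1}` is proved on the strip `1/2 < Re s < 1` (`rightMellin_scalingOp`:
  `f̂(s) = c/(1−s) + ⟪k_s, f⟫` for `f` constant on `(0,1)`, `rightMellin_eq_of_ae_eq_const`, with the
  `L²` vector `k_s = 1_{t>1}\overline{t^{−s}}`, so that `f̂` commutes with the Bochner integral; and
  Mathlib's `mellin_comp_mul_left` for each dilate) and continued by the uniqueness of the continuation
  (`HasRightMellinContinuation.eqOn`, `hasRightMellinContinuation_rightMellinExt_of_mem_sonineL`).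

## References
* [Burnol2004b] J.-F. Burnol, J. Théor. Nombres Bordeaux 16 (2004) 65–94 = arXiv:math/0203120v7, §4
  Thm. 4.9 (p. 11, TeX l.899–944), Prop. 4.6, Thm. 4.8.
* [ConnesConsani2021] A. Connes, C. Consani, Selecta Math. 27 (2021) 77, §4 eq. (40) (the unitary
  scaling `ϑ`; tree `ScalingOperator.lean`).
* [Grafakos2014] L. Grafakos, *Classical Fourier Analysis*, 3rd ed., Prop. 2.2.11 (8) (dilation law of
  `𝓕`; tree `L2FourierDilation.lean`).
-/

noncomputable section

open MeasureTheory Complex Filter Set Topology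
open scoped ComplexConjugate FourierTransform ENNReal InnerProductSpace

namespace Literature.NumberTheory.LFunctions

namespace BurnolScriptL1Density

open Literature.NumberTheory.ConnesConsani2021 (scalingUnitary scalingOp scalingUnitary_coeFn
  scalingUnitary_apply norm_scalingUnitary_apply scalingUnitary_zero continuous_scalingUnitary_apply
  integrable_smul_scalingUnitary scalingOp_apply evenPart mem_evenPart_iff isClosed_evenPart)

/-! ## A. The Mellin multiplier `Θ_w(s) = ∫ w(τ) e^{τ(1/2 − s)} dτ` of a compactly supported weight -/

/- Throughout, the Mellin-side multiplier of the multiplicative mollifier with (additive-avatar)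
weight `w` is written out as `Θ_w(s) = ∫ τ, w τ * cexp (τ * (1/2 − s))` (Burnol's `θ(ε(s − 1/2) + 1/2)`
for `w = ψ_ε`); this module declares no definitions. -/

/-- Pointwise size of the kernel: `‖e^{τ(1/2 − s)}‖ = e^{τ(1/2 − Re s)}`. [folklore] -/
private theorem norm_cexp_mul_half_sub (τ : ℝ) (s : ℂ) :
    ‖cexp ((τ : ℂ) * (1 / 2 - s))‖ = Real.exp (τ * (1 / 2 - s.re)) := by
  rw [Complex.norm_exp]
  congr 1
  simp [Complex.mul_re]

/-- On `|τ| ≤ R` the kernel is bounded by `e^{R |1/2 − Re s|}`. [folklore] -/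
private theorem norm_cexp_mul_half_sub_le {τ R : ℝ} (hτ : |τ| ≤ R) (s : ℂ) :
    ‖cexp ((τ : ℂ) * (1 / 2 - s))‖ ≤ Real.exp (R * |1 / 2 - s.re|) := by
  rw [norm_cexp_mul_half_sub]
  apply Real.exp_le_exp.2
  calc τ * (1 / 2 - s.re) ≤ |τ * (1 / 2 - s.re)| := le_abs_self _
    _ = |τ| * |1 / 2 - s.re| := abs_mul _ _
    _ ≤ R * |1 / 2 - s.re| := by gcongr

/-- Support bookkeeping: `w τ ≠ 0` forces `|τ| ≤ R` when `tsupport w ⊆ [−R, R]`. [folklore] -/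
private theorem abs_le_of_tsupport_subset {w : ℝ → ℂ} {R : ℝ} (hR : tsupport w ⊆ Icc (-R) R) {τ : ℝ}
    (hτ : w τ ≠ 0) : |τ| ≤ R :=
  abs_le.2 (hR (subset_tsupport _ hτ))

/-- The iterated derivatives of a compactly supported function are supported in the same set.
[folklore] -/
private theorem tsupport_iterate_deriv_subset (w : ℝ → ℂ) (N : ℕ) : tsupport (deriv^[N] w) ⊆ tsupport w := by
  induction N with
  | zero => simp
  | succ N ih =>
    rw [Function.iterate_succ_apply']
    exact tsupport_deriv_subset.trans ih

/-- The iterated derivatives of a compactly supported function are compactly supported. [folklore] -/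
private theorem hasCompactSupport_iterate_deriv {w : ℝ → ℂ} (hws : HasCompactSupport w) (N : ℕ) :
    HasCompactSupport (deriv^[N] w) := by
  induction N with
  | zero => simpa using hws
  | succ N ih =>
    rw [Function.iterate_succ_apply']
    exact ih.deriv

/-- The trivial bound `‖Θ_w(s)‖ ≤ e^{R|1/2 − Re s|} ‖w‖_{L¹}` for a weight supported in `[−R, R]`.
[cite: Burnol2004b, proof of Thm. 4.9 (arXiv:math/0203120v7 p. 11, TeX l.912–917)] -/
theorem norm_mollMultiplier_le {w : ℝ → ℂ} (hw : Continuous w) (hws : HasCompactSupport w) {R : ℝ}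
    (hR : tsupport w ⊆ Icc (-R) R) (s : ℂ) :
    ‖∫ τ : ℝ, w τ * cexp ((τ : ℂ) * (1 / 2 - s))‖ ≤ Real.exp (R * |1 / 2 - s.re|) * ∫ τ : ℝ, ‖w τ‖ := by
  have hwi : Integrable (fun τ : ℝ ↦ ‖w τ‖) := (hw.integrable_of_hasCompactSupport hws).norm
  calc ‖∫ τ : ℝ, w τ * cexp ((τ : ℂ) * (1 / 2 - s))‖
      ≤ ∫ τ : ℝ, ‖w τ * cexp ((τ : ℂ) * (1 / 2 - s))‖ := norm_integral_le_integral_norm _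
    _ ≤ ∫ τ : ℝ, Real.exp (R * |1 / 2 - s.re|) * ‖w τ‖ := by
        refine integral_mono_of_nonneg (Eventually.of_forall fun τ ↦ norm_nonneg _) (hwi.const_mul _)
          (Eventually.of_forall fun τ ↦ ?_)
        dsimp only
        by_cases hw0 : w τ = 0
        · simp [hw0]
        · rw [norm_mul, mul_comm]
          exact mul_le_mul_of_nonneg_right (norm_cexp_mul_half_sub_le
            (abs_le_of_tsupport_subset hR hw0) s) (norm_nonneg _)
    _ = Real.exp (R * |1 / 2 - s.re|) * ∫ τ : ℝ, ‖w τ‖ := integral_const_mul _ _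

/-- Every compactly supported weight is supported in some `[−R, R]`, `R ≥ 0`. [folklore] -/
private theorem exists_tsupport_subset_Icc {w : ℝ → ℂ} (hws : HasCompactSupport w) :
    ∃ R : ℝ, 0 ≤ R ∧ tsupport w ⊆ Icc (-R) R := by
  obtain ⟨R, hR⟩ := (hws.isCompact.isBounded).subset_closedBall 0
  refine ⟨max R 0, le_max_right _ _, fun τ hτ ↦ ?_⟩
  have : |τ| ≤ R := by simpa [Real.norm_eq_abs] using hR hτ
  rw [mem_Icc, ← abs_le]
  exact this.trans (le_max_left _ _)

/-- The integrand of `Θ_w` is integrable for a continuous compactly supported weight. [folklore] -/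
private theorem integrable_mollMultiplier_integrand {w : ℝ → ℂ} (hw : Continuous w)
    (hws : HasCompactSupport w) (s : ℂ) :
    Integrable (fun τ : ℝ ↦ w τ * cexp ((τ : ℂ) * (1 / 2 - s))) := by
  refine (Continuous.integrable_of_hasCompactSupport (hw.mul (by fun_prop)) ?_)
  exact hws.mul_right

/-- **`Θ_w` is entire** (differentiation under the integral sign: the integrand is entire in `s`
with derivative `−τ w(τ) e^{τ(1/2−s)}`, dominated on bounded sets of `s` by a continuous compactly
supported function of `τ`). [cite: Burnol2004b, proof of Thm. 4.9 (arXiv:math/0203120v7 p. 11, TeX l.912–917: "θ(s) is an entire function")] -/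
theorem differentiable_mollMultiplier {w : ℝ → ℂ} (hw : Continuous w) (hws : HasCompactSupport w) :
    Differentiable ℂ (fun s : ℂ ↦ ∫ τ : ℝ, w τ * cexp ((τ : ℂ) * (1 / 2 - s))) := by
  obtain ⟨R, -, hR'⟩ := exists_tsupport_subset_Icc hws
  have hR : ∀ τ, w τ ≠ 0 → |τ| ≤ R := fun τ hτ ↦ abs_le_of_tsupport_subset hR' hτ
  intro s₀
  set F : ℂ → ℝ → ℂ := fun s τ ↦ w τ * cexp ((τ : ℂ) * (1 / 2 - s)) with hF
  set F' : ℂ → ℝ → ℂ := fun s τ ↦ w τ * (-(τ : ℂ) * cexp ((τ : ℂ) * (1 / 2 - s))) with hF'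
  set bound : ℝ → ℝ := fun τ ↦ ‖w τ‖ * (|τ| * Real.exp (R * (|1 / 2 - s₀.re| + 1))) with hbound
  have hs : Metric.ball s₀ 1 ∈ 𝓝 s₀ := Metric.ball_mem_nhds _ one_pos
  have hF_meas : ∀ᶠ s in 𝓝 s₀, AEStronglyMeasurable (F s) volume :=
    Eventually.of_forall fun s ↦ (integrable_mollMultiplier_integrand hw hws s).aestronglyMeasurable
  have hF_int : Integrable (F s₀) := integrable_mollMultiplier_integrand hw hws s₀
  have hF'_meas : AEStronglyMeasurable (F' s₀) volume := by
    refine (Continuous.aestronglyMeasurable ?_)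
    exact hw.mul (by fun_prop)
  have h_bound : ∀ᵐ τ : ℝ, ∀ s ∈ Metric.ball s₀ 1, ‖F' s τ‖ ≤ bound τ := by
    refine Eventually.of_forall fun τ s hs ↦ ?_
    by_cases hw0 : w τ = 0
    · simp [hF', hbound, hw0]
    have hτ := hR τ hw0
    simp only [hF', hbound, norm_mul, norm_neg, Complex.norm_real, Real.norm_eq_abs]
    refine mul_le_mul_of_nonneg_left ?_ (norm_nonneg _)
    refine mul_le_mul_of_nonneg_left ?_ (abs_nonneg _)
    refine (norm_cexp_mul_half_sub_le hτ s).trans (Real.exp_le_exp.2 ?_)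
    refine mul_le_mul_of_nonneg_left ?_ ((abs_nonneg τ).trans hτ)
    have h1 : ‖s - s₀‖ < 1 := by simpa [dist_eq_norm] using hs
    have h2 : |s.re - s₀.re| < 1 := by
      calc |s.re - s₀.re| = |(s - s₀).re| := by simp
        _ ≤ ‖s - s₀‖ := Complex.abs_re_le_norm _
        _ < 1 := h1
    have := abs_sub_abs_le_abs_sub (1 / 2 - s.re) (1 / 2 - s₀.re)
    rw [show 1 / 2 - s.re - (1 / 2 - s₀.re) = -(s.re - s₀.re) by ring, abs_neg] at this
    linarith
  have hbound_int : Integrable bound := by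
    refine Continuous.integrable_of_hasCompactSupport (by fun_prop) ?_
    exact hws.norm.mul_right
  have h_diff : ∀ᵐ τ : ℝ, ∀ s ∈ Metric.ball s₀ 1, HasDerivAt (F · τ) (F' s τ) s := by
    refine Eventually.of_forall fun τ s _ ↦ ?_
    simp only [hF, hF']
    refine HasDerivAt.const_mul (w τ) ?_
    have h1 : HasDerivAt (fun s : ℂ ↦ (τ : ℂ) * (1 / 2 - s)) (-(τ : ℂ)) s := by
      have := ((hasDerivAt_id s).const_sub (1 / 2 : ℂ)).const_mul (τ : ℂ)
      simpa using this
    have h2 := h1.cexp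
    simpa [mul_comm] using h2
  exact (hasDerivAt_integral_of_dominated_loc_of_deriv_le hs hF_meas hF_int hF'_meas h_bound
    hbound_int h_diff).2.differentiableAt

/-- **Integration by parts**: for a `C¹` compactly supported weight and `s ≠ 1/2`,
`Θ_w(s) = −(1/2 − s)⁻¹ Θ_{w'}(s)`. [cite: Burnol2004b, proof of Thm. 4.9 (arXiv:math/0203120v7 p. 11, TeX l.914–917: "decreases faster than any (inverse) power of |s| … in any given strip")] -/
theorem mollMultiplier_eq_deriv {w : ℝ → ℂ} (hw : ContDiff ℝ 1 w) (hws : HasCompactSupport w)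
    {s : ℂ} (hs : s ≠ 1 / 2) :
    (∫ τ : ℝ, w τ * cexp ((τ : ℂ) * (1 / 2 - s))) =
      -((1 / 2 - s)⁻¹ * ∫ τ : ℝ, deriv w τ * cexp ((τ : ℂ) * (1 / 2 - s))) := by
  have hu : (1 / 2 - s : ℂ) ≠ 0 := sub_ne_zero.2 (Ne.symm hs)
  have hwc : Continuous w := hw.continuous
  have hw' : Continuous (deriv w) := hw.continuous_deriv le_rfl
  have hws' : HasCompactSupport (deriv w) := hws.deriv
  -- `v(τ) = (1/2 − s)⁻¹ e^{τ(1/2−s)}`, `v' = e^{τ(1/2−s)}`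
  set v : ℝ → ℂ := fun τ ↦ (1 / 2 - s)⁻¹ * cexp ((τ : ℂ) * (1 / 2 - s)) with hv
  set v' : ℝ → ℂ := fun τ ↦ cexp ((τ : ℂ) * (1 / 2 - s)) with hv'
  have hvd : ∀ τ : ℝ, HasDerivAt v (v' τ) τ := by
    intro τ
    have h1 : HasDerivAt (fun τ : ℝ ↦ (τ : ℂ) * (1 / 2 - s)) (1 * (1 / 2 - s)) τ :=
      (Complex.ofRealCLM.hasDerivAt).mul_const _
    have h2 := (h1.cexp).const_mul ((1 / 2 - s)⁻¹)
    refine h2.congr_deriv ?_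
    simp only [hv', one_mul]
    rw [mul_comm (cexp _), ← mul_assoc, inv_mul_cancel₀ hu, one_mul]
  have hwd : ∀ τ : ℝ, HasDerivAt w (deriv w τ) τ := fun τ ↦
    (hw.differentiable one_ne_zero τ).hasDerivAt
  have h := integral_mul_deriv_eq_deriv_mul_of_integrable (u := w) (u' := deriv w) (v := v) (v' := v')
    (fun τ _ ↦ hwd τ) (fun τ _ ↦ hvd τ)
    ((hwc.mul (by fun_prop)).integrable_of_hasCompactSupport hws.mul_right)
    ((hw'.mul (by fun_prop)).integrable_of_hasCompactSupport hws'.mul_right)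
    ((hwc.mul (by fun_prop)).integrable_of_hasCompactSupport hws.mul_right)
  rw [show (fun τ : ℝ ↦ w τ * cexp ((τ : ℂ) * (1 / 2 - s))) = fun τ ↦ w τ * v' τ from rfl, h]
  simp only [hv]
  rw [← integral_neg, ← integral_const_mul, ← integral_neg]
  congr 1
  funext τ
  ring

/-- Iterated integration by parts: `Θ_w(s) = (−(1/2 − s)⁻¹)^N Θ_{w^{(N)}}(s)` for a smooth compactly
supported weight. [cite: Burnol2004b, proof of Thm. 4.9 (arXiv:math/0203120v7 p. 11, TeX l.914–917)] -/
theorem mollMultiplier_eq_iterate_deriv {w : ℝ → ℂ} (hw : ContDiff ℝ (⊤ : ℕ∞) w)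
    (hws : HasCompactSupport w) {s : ℂ} (hs : s ≠ 1 / 2) (N : ℕ) :
    (∫ τ : ℝ, w τ * cexp ((τ : ℂ) * (1 / 2 - s))) =
      (-(1 / 2 - s)⁻¹) ^ N * ∫ τ : ℝ, deriv^[N] w τ * cexp ((τ : ℂ) * (1 / 2 - s)) := by
  induction N generalizing w with
  | zero => simp
  | succ N ih =>
    have h1 : ContDiff ℝ 1 w := hw.of_le (by exact_mod_cast le_top)
    rw [mollMultiplier_eq_deriv h1 hws hs, ih (w := deriv w) ?_ hws.deriv]
    · rw [Function.iterate_succ_apply, pow_succ]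
      ring
    · exact (contDiff_infty_iff_deriv.mp hw).2

/-- **Rapid decay of `Θ_w` in vertical strips**: for a smooth weight supported in `[−R, R]` and every
`N`, `‖Θ_w(s)‖ ≤ e^{R|1/2 − Re s|} ‖w^{(N)}‖_{L¹} |Im s|^{−N}` whenever `Im s ≠ 0`.
[cite: Burnol2004b, proof of Thm. 4.9 (arXiv:math/0203120v7 p. 11, TeX l.914–917)] -/
theorem norm_mollMultiplier_le_pow {w : ℝ → ℂ} (hw : ContDiff ℝ (⊤ : ℕ∞) w)
    (hws : HasCompactSupport w) {R : ℝ} (hR : tsupport w ⊆ Icc (-R) R) (N : ℕ)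
    {s : ℂ} (hs : s.im ≠ 0) :
    ‖∫ τ : ℝ, w τ * cexp ((τ : ℂ) * (1 / 2 - s))‖ ≤
      Real.exp (R * |1 / 2 - s.re|) * (∫ τ : ℝ, ‖deriv^[N] w τ‖) * |s.im|⁻¹ ^ N := by
  have hs' : s ≠ 1 / 2 := by
    intro h; rw [h] at hs; norm_num at hs
  have hRN : tsupport (deriv^[N] w) ⊆ Icc (-R) R := (tsupport_iterate_deriv_subset w N).trans hR
  rw [mollMultiplier_eq_iterate_deriv hw hws hs' N, norm_mul, norm_pow, norm_neg, norm_inv]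
  have hu : |s.im| ≤ ‖(1 / 2 : ℂ) - s‖ := by
    have := Complex.abs_im_le_norm ((1 / 2 : ℂ) - s)
    simpa using this
  have hwN : Continuous (deriv^[N] w) := (hw.iterate_deriv N).continuous
  have hwsN : HasCompactSupport (deriv^[N] w) := hasCompactSupport_iterate_deriv hws N
  have h1 : ‖(1 / 2 : ℂ) - s‖⁻¹ ^ N ≤ |s.im|⁻¹ ^ N :=
    pow_le_pow_left₀ (inv_nonneg.2 (norm_nonneg _)) (inv_anti₀ (abs_pos.2 hs) hu) N
  have h2 := norm_mollMultiplier_le hwN hwsN hRN s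
  calc ‖(1 / 2 : ℂ) - s‖⁻¹ ^ N * ‖∫ τ : ℝ, deriv^[N] w τ * cexp ((τ : ℂ) * (1 / 2 - s))‖
      ≤ |s.im|⁻¹ ^ N * (Real.exp (R * |1 / 2 - s.re|) * ∫ τ : ℝ, ‖deriv^[N] w τ‖) :=
        mul_le_mul h1 h2 (norm_nonneg _) (pow_nonneg (inv_nonneg.2 (abs_nonneg _)) N)
    _ = _ := by ring

/-! ## B. The multiplicative mollifier `ϑ(w) g = ∫ w(τ) ϑ(e^τ) g dτ` on `L²(ℝ)`

`ϑ(e^τ)` is the tree's `scalingUnitary τ` (`(ϑ(e^τ)η)(v) = e^{−τ/2} η(e^{−τ}v)`, Connes–Consani's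
unitary scaling) and `ϑ(w) = scalingOp w` its Bochner integral against an `L¹` weight: for `w ≥ 0` of mass
one supported in `[−ε, ε]` this is exactly Burnol's "multiplicative convolution on `(0, ∞)` … with a
smooth function supported in `[exp(−ε), exp(ε)]`" (TeX l.925–928), transported to even functions on `ℝ`. -/

/-- Quasi-measure-preservation of `x ↦ c x` (`c ≠ 0`) for Lebesgue measure. [folklore] -/
private theorem quasiMeasurePreserving_mul_left {c : ℝ} (hc : c ≠ 0) :
    Measure.QuasiMeasurePreserving (fun x : ℝ ↦ c * x) volume volume :=
  (Literature.Analysis.Fourier.measurePreserving_mul_left hc).quasiMeasurePreserving.mono_right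
    Measure.smul_absolutelyContinuous

/-- **Dilates of a function constant near `0⁺`.** If `h = c` a.e. on `(0, b)` and `e^{−τ} ≤ b`, then
`ϑ(e^τ)h = e^{−τ/2} c` a.e. on `(0, 1)`. [cite: Burnol2004b, proof of Thm. 4.9 (arXiv:math/0203120v7 p. 11, TeX l.925–931: "the support of this multiplicative convolution will be included in [1,∞) if 1 ≤ exp(−ε)b")] -/
theorem scalingUnitary_ae_const_Ioo {h : Lp ℂ 2 (volume : Measure ℝ)} {b : ℝ} {c : ℂ}
    (hc : ∀ᵐ x : ℝ, x ∈ Ioo 0 b → (h : ℝ → ℂ) x = c) {τ : ℝ} (hτ : Real.exp (-τ) ≤ b) :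
    ∀ᵐ x : ℝ, x ∈ Ioo (0 : ℝ) 1 →
      (scalingUnitary τ h : ℝ → ℂ) x = (Real.exp (-τ / 2) : ℂ) * c := by
  have hq := quasiMeasurePreserving_mul_left (Real.exp_pos (-τ)).ne'
  filter_upwards [scalingUnitary_coeFn τ h, hq.ae hc] with x hx hx' hx01
  rw [hx, hx' ⟨mul_pos (Real.exp_pos _) hx01.1, ?_⟩]
  calc Real.exp (-τ) * x < Real.exp (-τ) * 1 := by gcongr; exact hx01.2
    _ ≤ b := by simpa using hτ

/-- **`ϑ(e^τ)` preserves even functions.** [cite: ConnesConsani2021, §4 eq. (40) p. 15 ("ϑ acts on L²(ℝ)_ev")] -/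
theorem scalingUnitary_mem_evenPart {g : Lp ℂ 2 (volume : Measure ℝ)} (hg : g ∈ evenPart) (τ : ℝ) :
    scalingUnitary τ g ∈ evenPart := by
  rw [mem_evenPart_iff] at hg ⊢
  have hcoe := scalingUnitary_coeFn τ g
  have h1 := (Measure.measurePreserving_neg (volume : Measure ℝ)).quasiMeasurePreserving.ae_eq_comp
    hcoe
  have h2 := (quasiMeasurePreserving_mul_left (Real.exp_pos (-τ)).ne').ae hg
  filter_upwards [hcoe, h1, h2] with x hx h1x h2x
  simp only [Function.comp_apply] at h1x
  rw [h1x, hx, mul_neg, h2x]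

/-- `(0,1)` has finite Lebesgue measure. [folklore] -/
private theorem volume_Ioo_zero_one_ne_top : volume (Ioo (0 : ℝ) 1) ≠ ∞ := by
  rw [Real.volume_Ioo]; exact ENNReal.ofReal_ne_top

/- Below, `1_{(0,1)}·` is the bounded operator `indicatorLp volume 2 (measurableSet_Ioo : (0,1))` of
`Literature/Analysis/OperatorTheory/TightSupNormCompactOperator.lean` and `𝟙 = indicatorConstLp 2 … 1`
is the `L²` class of `1_{(0,1)}` (written out; no definitions in this module). -/

/-- `1_{(0,1)} f = c · 1_{(0,1)}` when `f = c` a.e. on `(0,1)`. [folklore] -/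
private theorem projIoo_eq_smul {f : Lp ℂ 2 (volume : Measure ℝ)} {c : ℂ}
    (hf : ∀ᵐ x : ℝ, x ∈ Ioo (0 : ℝ) 1 → (f : ℝ → ℂ) x = c) :
    Literature.Analysis.OperatorTheory.indicatorLp (volume : Measure ℝ) 2
        (measurableSet_Ioo : MeasurableSet (Ioo (0 : ℝ) 1)) f =
      c • indicatorConstLp 2 (measurableSet_Ioo : MeasurableSet (Ioo (0 : ℝ) 1))
        volume_Ioo_zero_one_ne_top (1 : ℂ) := by
  apply Lp.ext
  filter_upwards [Literature.Analysis.OperatorTheory.indicatorLp_coeFn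
      (measurableSet_Ioo : MeasurableSet (Ioo (0 : ℝ) 1)) f,
    Lp.coeFn_smul c (indicatorConstLp 2 (measurableSet_Ioo : MeasurableSet (Ioo (0 : ℝ) 1))
      volume_Ioo_zero_one_ne_top (1 : ℂ)), indicatorConstLp_coeFn (p := 2)
      (s := Ioo (0 : ℝ) 1) (hs := measurableSet_Ioo) (hμs := volume_Ioo_zero_one_ne_top) (c := (1 : ℂ)),
    hf] with x h1 h2 h3 h4
  rw [h1, h2, Pi.smul_apply, h3]
  by_cases hx : x ∈ Ioo (0 : ℝ) 1
  · rw [indicator_of_mem hx, indicator_of_mem hx, h4 hx, smul_eq_mul, mul_one]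
  · rw [indicator_of_notMem hx, indicator_of_notMem hx, smul_zero]

/-- Conversely `1_{(0,1)} f = c · 1_{(0,1)}` forces `f = c` a.e. on `(0,1)`. [folklore] -/
private theorem ae_const_of_projIoo_eq_smul {f : Lp ℂ 2 (volume : Measure ℝ)} {c : ℂ}
    (h : Literature.Analysis.OperatorTheory.indicatorLp (volume : Measure ℝ) 2
        (measurableSet_Ioo : MeasurableSet (Ioo (0 : ℝ) 1)) f =
      c • indicatorConstLp 2 (measurableSet_Ioo : MeasurableSet (Ioo (0 : ℝ) 1))
        volume_Ioo_zero_one_ne_top (1 : ℂ)) :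
    ∀ᵐ x : ℝ, x ∈ Ioo (0 : ℝ) 1 → (f : ℝ → ℂ) x = c := by
  have h' : ((Literature.Analysis.OperatorTheory.indicatorLp (volume : Measure ℝ) 2
        (measurableSet_Ioo : MeasurableSet (Ioo (0 : ℝ) 1)) f : Lp ℂ 2 (volume : Measure ℝ)) :
          ℝ → ℂ) =ᵐ[volume]
      ((c • indicatorConstLp 2 (measurableSet_Ioo : MeasurableSet (Ioo (0 : ℝ) 1))
        volume_Ioo_zero_one_ne_top (1 : ℂ) : Lp ℂ 2 (volume : Measure ℝ)) : ℝ → ℂ) := by rw [h]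
  filter_upwards [Literature.Analysis.OperatorTheory.indicatorLp_coeFn
      (measurableSet_Ioo : MeasurableSet (Ioo (0 : ℝ) 1)) f,
    Lp.coeFn_smul c (indicatorConstLp 2 (measurableSet_Ioo : MeasurableSet (Ioo (0 : ℝ) 1))
      volume_Ioo_zero_one_ne_top (1 : ℂ)), indicatorConstLp_coeFn (p := 2)
      (s := Ioo (0 : ℝ) 1) (hs := measurableSet_Ioo) (hμs := volume_Ioo_zero_one_ne_top) (c := (1 : ℂ)),
    h'] with x h1 h2 h3 h4 hx
  have := h4
  rw [h1, h2, Pi.smul_apply, h3, indicator_of_mem hx, indicator_of_mem hx,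
    smul_eq_mul, mul_one] at this
  exact this

/-- **The mollifier of a function constant near `0⁺` is constant near `0⁺`:** if `h = c` a.e. on
`(0,b)` and the weight lives on `{τ : e^{−τ} ≤ b}`, then `ϑ(w)h = c ∫ w(τ)e^{−τ/2}dτ` a.e. on `(0,1)`
(the bounded operator `1_{(0,1)}·` commutes with the Bochner integral).
[cite: Burnol2004b, proof of Thm. 4.9 (arXiv:math/0203120v7 p. 11, TeX l.925–931)] -/
theorem scalingOp_ae_const_Ioo {w : ℝ → ℂ} (hw : Integrable w) {b : ℝ}
    (hwb : ∀ τ, w τ ≠ 0 → Real.exp (-τ) ≤ b) {h : Lp ℂ 2 (volume : Measure ℝ)} {c : ℂ}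
    (hc : ∀ᵐ x : ℝ, x ∈ Ioo 0 b → (h : ℝ → ℂ) x = c) :
    ∀ᵐ x : ℝ, x ∈ Ioo (0 : ℝ) 1 →
      (scalingOp w h : ℝ → ℂ) x = c * ∫ τ : ℝ, w τ * (Real.exp (-τ / 2) : ℂ) := by
  apply ae_const_of_projIoo_eq_smul
  rw [scalingOp_apply hw, ← ContinuousLinearMap.integral_comp_comm _ (integrable_smul_scalingUnitary hw h)]
  have hpt : ∀ τ : ℝ, Literature.Analysis.OperatorTheory.indicatorLp (volume : Measure ℝ) 2
      (measurableSet_Ioo : MeasurableSet (Ioo (0 : ℝ) 1)) (w τ • scalingUnitary τ h) =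
      (w τ * (Real.exp (-τ / 2) : ℂ) * c) • indicatorConstLp 2
        (measurableSet_Ioo : MeasurableSet (Ioo (0 : ℝ) 1)) volume_Ioo_zero_one_ne_top (1 : ℂ) := by
    intro τ
    by_cases hτ : w τ = 0
    · simp [hτ]
    · rw [map_smul, projIoo_eq_smul (scalingUnitary_ae_const_Ioo hc (hwb τ hτ)), smul_smul, mul_assoc]
  simp_rw [hpt]
  rw [integral_smul_const, integral_mul_const, mul_comm]

/-- **The mollifier of an even function is even** (the closed subspace `L²(ℝ)_ev` is stable under
each `ϑ(e^τ)` and under Bochner integration, via its orthogonal complement).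
[cite: ConnesConsani2021, §4 eq. (40) p. 15 ("ϑ acts on L²(ℝ)_ev"); Burnol2004b, proof of Thm. 4.9 (arXiv:math/0203120v7 p. 11, TeX l.923–931)] -/
theorem scalingOp_mem_evenPart {w : ℝ → ℂ} (hw : Integrable w) {g : Lp ℂ 2 (volume : Measure ℝ)}
    (hg : g ∈ evenPart) : scalingOp w g ∈ evenPart := by
  haveI : CompleteSpace (evenPart : Submodule ℂ (Lp ℂ 2 (volume : Measure ℝ))) :=
    isClosed_evenPart.completeSpace_coe
  rw [← Submodule.orthogonal_orthogonal (evenPart : Submodule ℂ (Lp ℂ 2 (volume : Measure ℝ))),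
    Submodule.mem_orthogonal]
  intro y hy
  rw [scalingOp_apply hw, ← integral_inner (integrable_smul_scalingUnitary hw g)]
  refine integral_eq_zero_of_ae (Eventually.of_forall fun τ ↦ ?_)
  simp only [Pi.zero_apply, inner_smul_right]
  rw [Submodule.inner_left_of_mem_orthogonal (scalingUnitary_mem_evenPart hg τ) hy, mul_zero]

/-- **`𝓕` intertwines `ϑ(e^τ)` and `ϑ(e^{−τ})`**: `𝓕(ϑ(e^τ)g) = ϑ(e^{−τ})𝓕g` on `L²(ℝ)` (the dilation law
`𝓕(g(c·)) = |c|⁻¹(𝓕g)(c⁻¹·)`). [cite: ConnesConsani2021, Prop. 4.5 (iv) proof, §4 p. 17 ("𝔽 ∘ ϑ(λ) = ϑ(λ⁻¹) ∘ 𝔽")] -/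
theorem fourier_scalingUnitary (τ : ℝ) (g : Lp ℂ 2 (volume : Measure ℝ)) :
    (𝓕 (scalingUnitary τ g) : Lp ℂ 2 (volume : Measure ℝ)) =
      scalingUnitary (-τ) (𝓕 g : Lp ℂ 2 (volume : Measure ℝ)) := by
  have hc : Real.exp (-τ) ≠ 0 := (Real.exp_pos _).ne'
  set D : Lp ℂ 2 (volume : Measure ℝ) :=
    Literature.Analysis.OperatorTheory.lpDilation (V := ℝ) (F := ℂ) (p := (2 : ℝ≥0∞)) (Real.exp (-τ))
      hc ENNReal.ofNat_ne_top g with hD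
  have hDcoe : (D : ℝ → ℂ) =ᵐ[volume] fun x ↦ (g : ℝ → ℂ) (Real.exp (-τ) * x) := by
    filter_upwards [Literature.Analysis.OperatorTheory.lpDilation_coeFn (V := ℝ) (F := ℂ)
      (p := (2 : ℝ≥0∞)) hc ENNReal.ofNat_ne_top g] with x hx
    rw [hx, smul_eq_mul]
  have hFD := Literature.Analysis.Fourier.fourier_comp_mul_left_ae_eq hc hDcoe
  have hϑ : scalingUnitary τ g = (Real.exp (-τ / 2) : ℂ) • D := by rw [scalingUnitary_apply]
  rw [hϑ, FourierTransform.fourier_smul]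
  apply Lp.ext
  filter_upwards [Lp.coeFn_smul (Real.exp (-τ / 2) : ℂ) (𝓕 D : Lp ℂ 2 (volume : Measure ℝ)), hFD,
    scalingUnitary_coeFn (-τ) (𝓕 g : Lp ℂ 2 (volume : Measure ℝ))] with ξ h1 h2 h3
  rw [h1, Pi.smul_apply, h2, h3]
  simp only [neg_neg, Real.exp_neg, inv_inv, abs_inv, abs_of_pos (Real.exp_pos τ), smul_eq_mul,
    Complex.real_smul]
  rw [← mul_assoc, ← Complex.ofReal_mul, ← Real.exp_add, show -τ / 2 + τ = τ / 2 by ring]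

/-- The `L²` Fourier transform commutes with the Bochner integral and `τ ↦ −τ` preserves Lebesgue
measure: **`𝓕(ϑ(w)g) = ϑ(w(−·))𝓕g`** ("its image under `𝓕₊` is `θ(−ε(s−1/2)+1/2)𝓕₊(G)(s)`").
[cite: Burnol2004b, proof of Thm. 4.9 (arXiv:math/0203120v7 p. 11, TeX l.932–940)] -/
theorem fourier_scalingOp {w : ℝ → ℂ} (hw : Integrable w) (g : Lp ℂ 2 (volume : Measure ℝ)) :
    (𝓕 (scalingOp w g) : Lp ℂ 2 (volume : Measure ℝ)) =
      scalingOp (fun τ ↦ w (-τ)) (𝓕 g : Lp ℂ 2 (volume : Measure ℝ)) := by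
  rw [scalingOp_apply hw, scalingOp_apply hw.comp_neg]
  change (Lp.fourierTransformₗᵢ ℝ ℂ).toLinearIsometry (∫ τ, w τ • scalingUnitary τ g) = _
  rw [← LinearIsometry.integral_comp_comm]
  have h1 : (fun τ : ℝ ↦ (Lp.fourierTransformₗᵢ ℝ ℂ).toLinearIsometry (w τ • scalingUnitary τ g)) =
      fun τ ↦ w τ • scalingUnitary (-τ) (𝓕 g : Lp ℂ 2 (volume : Measure ℝ)) := by
    funext τ
    rw [map_smul]
    exact congrArg _ (fourier_scalingUnitary τ g)
  rw [h1]
  have h2 := integral_neg_eq_self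
    (fun τ : ℝ ↦ w (-τ) • scalingUnitary τ (𝓕 g : Lp ℂ 2 (volume : Measure ℝ))) volume
  simp only [neg_neg] at h2
  exact h2

/-- **Approximation.** If `∫ w = 1` and `‖ϑ(e^τ)g − g‖ ≤ δ` on the support of `w`, then
`‖ϑ(w)g − g‖ ≤ δ ‖w‖_{L¹}` ("they … converge in `L²`-norm to `G(s)`").
[cite: Burnol2004b, proof of Thm. 4.9 (arXiv:math/0203120v7 p. 11, TeX l.919–921)] -/
theorem norm_scalingOp_sub_le {w : ℝ → ℂ} (hw : Integrable w) (hw1 : ∫ τ, w τ = 1)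
    (g : Lp ℂ 2 (volume : Measure ℝ)) {δ : ℝ} (_hδ : 0 ≤ δ)
    (hg : ∀ τ, w τ ≠ 0 → ‖scalingUnitary τ g - g‖ ≤ δ) :
    ‖scalingOp w g - g‖ ≤ δ * ∫ τ, ‖w τ‖ := by
  have hI := integrable_smul_scalingUnitary hw g
  have hI' : Integrable (fun τ : ℝ ↦ w τ • g) := hw.smul_const g
  have hg' : ∫ τ, w τ • g = g := by rw [integral_smul_const, hw1, one_smul]
  have hsub : ∫ τ, w τ • (scalingUnitary τ g - g) = (∫ τ, w τ • scalingUnitary τ g) - g := by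
    simp_rw [smul_sub]
    rw [integral_sub hI hI', hg']
  rw [scalingOp_apply hw, ← hsub]
  calc ‖∫ τ, w τ • (scalingUnitary τ g - g)‖ ≤ ∫ τ, ‖w τ • (scalingUnitary τ g - g)‖ :=
        norm_integral_le_integral_norm _
    _ ≤ ∫ τ, δ * ‖w τ‖ := by
        refine integral_mono_of_nonneg (Eventually.of_forall fun _ ↦ norm_nonneg _)
          (hw.norm.const_mul δ) (Eventually.of_forall fun τ ↦ ?_)
        dsimp only
        by_cases hτ : w τ = 0
        · simp [hτ]
        · rw [norm_smul, mul_comm]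
          exact mul_le_mul_of_nonneg_right (hg τ hτ) (norm_nonneg _)
    _ = δ * ∫ τ, ‖w τ‖ := integral_const_mul _ _

/-! ## C. The right Mellin transform of the mollifier on the strip `1/2 < Re s < 1`

`f̂` is not a continuous functional on `L²`, but on functions constant `= c` on `(0,1)` it splits as
`f̂(s) = c/(1−s) + ∫₁^∞ f t^{−s} dt` (`rightMellin_eq_of_ae_eq_const`), and the second term IS the inner
product with the `L²` vector `k_s = 1_{t>1} \overline{t^{−s}}`; so it commutes with the Bochner
integral, and `(ϑ(e^τ)g)^(s) = e^{τ(1/2−s)} ĝ(s)` (Mathlib's `mellin_comp_mul_left`) gives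
`(ϑ(w)g)^ = Θ_w · ĝ`. -/

/-- `((e^t : ℝ) : ℂ)^z = e^{tz}`. [folklore] -/
private theorem ofReal_exp_cpow (t : ℝ) (z : ℂ) : ((Real.exp t : ℝ) : ℂ) ^ z = cexp (t * z) := by
  rw [Complex.cpow_def_of_ne_zero (by exact_mod_cast (Real.exp_pos t).ne'), Complex.ofReal_exp,
    Complex.log_exp (by simp [Real.pi_pos]) (by simpa using Real.pi_pos.le)]

/-- **Right Mellin transform of a dilate**: `(ϑ(e^τ)g)^(s) = e^{τ(1/2 − s)} ĝ(s)` (substitution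
`t ↦ e^{τ}t` in the absolutely convergent integral; both sides are junk together otherwise).
[cite: Burnol2004b, proof of Thm. 4.9 (arXiv:math/0203120v7 p. 11, TeX l.921–925: "θ(ε(s−1/2)+1/2)…G(s) … is the Mellin transform of a multiplicative convolution")] -/
theorem rightMellin_scalingUnitary (τ : ℝ) (g : Lp ℂ 2 (volume : Measure ℝ)) (s : ℂ) :
    rightMellin (scalingUnitary τ g : ℝ → ℂ) s =
      cexp ((τ : ℂ) * (1 / 2 - s)) * rightMellin (g : ℝ → ℂ) s := by
  unfold rightMellin
  have h1 : mellin (scalingUnitary τ g : ℝ → ℂ) (1 - s) =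
      mellin (fun t ↦ (Real.exp (-τ / 2) : ℂ) * (g : ℝ → ℂ) (Real.exp (-τ) * t)) (1 - s) := by
    unfold mellin
    refine setIntegral_congr_ae measurableSet_Ioi ?_
    filter_upwards [scalingUnitary_coeFn τ g] with t ht _
    rw [ht]
  have h2 : mellin (fun t ↦ (Real.exp (-τ / 2) : ℂ) * (g : ℝ → ℂ) (Real.exp (-τ) * t)) (1 - s) =
      (Real.exp (-τ / 2) : ℂ) * mellin (fun t ↦ (g : ℝ → ℂ) (Real.exp (-τ) * t)) (1 - s) := by
    unfold mellin
    rw [← integral_const_mul]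
    congr 1
    funext t
    simp only [smul_eq_mul]
    ring
  rw [h1, h2, mellin_comp_mul_left _ _ (Real.exp_pos _), smul_eq_mul, ← mul_assoc]
  congr 1
  rw [ofReal_exp_cpow, Complex.ofReal_exp, ← Complex.exp_add]
  congr 1
  push_cast
  ring

/- The test vector `k_s(t) = 1_{t>1} · conj(t^{−s})` is written out as
`(Ioi 1).indicator fun t ↦ conj ((t : ℂ) ^ (-s))`; its `L²` class is `(memLp_kFun hs).toLp _`. -/

/-- `k_s` is measurable. [folklore] -/
private theorem measurable_kFun (s : ℂ) :
    Measurable ((Ioi (1 : ℝ)).indicator fun t : ℝ ↦ conj ((t : ℂ) ^ (-s))) := by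
  refine Measurable.indicator ?_ measurableSet_Ioi
  exact Complex.continuous_conj.measurable.comp (Complex.measurable_ofReal.pow_const (-s))

/-- `‖k_s(t)‖ = 1_{t>1} t^{−Re s}`. [folklore] -/
private theorem norm_kFun (s : ℂ) (t : ℝ) :
    ‖((Ioi (1 : ℝ)).indicator fun t : ℝ ↦ conj ((t : ℂ) ^ (-s))) t‖ = (Ioi (1 : ℝ)).indicator (fun t ↦ t ^ (-s.re)) t := by
  by_cases ht : t ∈ Ioi (1 : ℝ)
  · rw [indicator_of_mem ht, indicator_of_mem ht, RCLike.norm_conj,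
      Complex.norm_cpow_eq_rpow_re_of_pos (zero_lt_one.trans ht), neg_re]
  · rw [indicator_of_notMem ht, indicator_of_notMem ht, norm_zero]

/-- `k_s ∈ L²(ℝ)` for `Re s > 1/2`. [folklore] -/
private theorem memLp_kFun {s : ℂ} (hs : 1 / 2 < s.re) :
    MemLp ((Ioi (1 : ℝ)).indicator fun t : ℝ ↦ conj ((t : ℂ) ^ (-s))) 2 (volume : Measure ℝ) := by
  rw [memLp_two_iff_integrable_sq_norm (measurable_kFun s).aestronglyMeasurable]
  have : (fun t ↦ ‖((Ioi (1 : ℝ)).indicator fun t : ℝ ↦ conj ((t : ℂ) ^ (-s))) t‖ ^ 2) =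
      (Ioi (1 : ℝ)).indicator fun t ↦ t ^ (-(2 * s.re)) := by
    funext t
    rw [norm_kFun]
    by_cases ht : t ∈ Ioi (1 : ℝ)
    · rw [indicator_of_mem ht, indicator_of_mem ht, ← Real.rpow_natCast,
        ← Real.rpow_mul (zero_le_one.trans ht.le)]
      congr 1
      push_cast
      ring
    · simp [indicator_of_notMem ht]
  rw [this, integrable_indicator_iff measurableSet_Ioi]
  exact integrableOn_Ioi_rpow_of_lt (by linarith) zero_lt_one

/-- **`⟪k_s, f⟫ = ∫₁^∞ f(t) t^{−s} dt`**, i.e. the right Mellin transform of `1_{t>1} f` at `s`.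
[cite: Burnol2004b, §4 before Prop. 4.1 (arXiv:math/0203120v7 p. 7, TeX l.632–643)] -/
theorem inner_kLp {s : ℂ} (hs : 1 / 2 < s.re) (f : Lp ℂ 2 (volume : Measure ℝ)) :
    ⟪(memLp_kFun hs).toLp _, f⟫_ℂ = mellin ((Ioi (1 : ℝ)).indicator (f : ℝ → ℂ)) (1 - s) := by
  rw [MeasureTheory.L2.inner_def]
  have h1 : (fun x : ℝ ↦ ⟪(((memLp_kFun hs).toLp _ : Lp ℂ 2 (volume : Measure ℝ)) : ℝ → ℂ) x,
      (f : ℝ → ℂ) x⟫_ℂ) =ᵐ[volume]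
      (Ioi (1 : ℝ)).indicator fun t ↦ (t : ℂ) ^ (-s) * (f : ℝ → ℂ) t := by
    filter_upwards [MemLp.coeFn_toLp (memLp_kFun hs)] with x hx
    rw [hx]
    by_cases hxm : x ∈ Ioi (1 : ℝ)
    · rw [indicator_of_mem hxm, indicator_of_mem hxm, RCLike.inner_apply, RCLike.conj_conj, mul_comm]
    · rw [indicator_of_notMem hxm, indicator_of_notMem hxm, inner_zero_left]
  rw [integral_congr_ae h1, integral_indicator measurableSet_Ioi]
  unfold mellin
  rw [← integral_indicator measurableSet_Ioi, ← integral_indicator measurableSet_Ioi]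
  congr 1
  funext t
  by_cases ht : t ∈ Ioi (1 : ℝ)
  · have ht0 : t ∈ Ioi (0 : ℝ) := mem_Ioi.2 (zero_lt_one.trans (mem_Ioi.1 ht))
    rw [indicator_of_mem ht, indicator_of_mem ht0, indicator_of_mem ht, smul_eq_mul]
    congr 2
    ring
  · rw [indicator_of_notMem ht]
    by_cases ht0 : t ∈ Ioi (0 : ℝ)
    · rw [indicator_of_mem ht0, indicator_of_notMem ht, smul_zero]
    · rw [indicator_of_notMem ht0]

/-- `f̂(s) = c/(1−s) + ⟪k_s, f⟫` for `f ∈ L²` equal to `c` a.e. on `(0,1)`, `1/2 < Re s < 1`.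
[cite: Burnol2004b, §4 before Prop. 4.1 (arXiv:math/0203120v7 p. 7, TeX l.632–643)] -/
theorem rightMellin_eq_const_add_inner {f : Lp ℂ 2 (volume : Measure ℝ)} {c : ℂ}
    (hfc : ∀ᵐ x : ℝ, x ∈ Ioo (0 : ℝ) 1 → (f : ℝ → ℂ) x = c) {s : ℂ} (hs1 : 1 / 2 < s.re)
    (hs2 : s.re < 1) :
    rightMellin (f : ℝ → ℂ) s = c / (1 - s) + ⟪(memLp_kFun hs1).toLp _, f⟫_ℂ := by
  rw [rightMellin_eq_of_ae_eq_const one_pos (f : ℝ → ℂ) (Lp.memLp f) hfc hs1 hs2, inner_kLp hs1,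
    Complex.ofReal_one, one_cpow, mul_one]

/-- `⟪k_s, ϑ(e^τ)g⟫ = e^{τ(1/2−s)}ĝ(s) − e^{−τ/2}c/(1−s)` for `g` constant `= c` on `(0,b)`, `e^{−τ} ≤ b`.
[cite: Burnol2004b, proof of Thm. 4.9 (arXiv:math/0203120v7 p. 11, TeX l.921–931)] -/
theorem inner_kLp_scalingUnitary {g : Lp ℂ 2 (volume : Measure ℝ)} {b : ℝ} {c : ℂ}
    (hc : ∀ᵐ x : ℝ, x ∈ Ioo 0 b → (g : ℝ → ℂ) x = c) {τ : ℝ} (hτ : Real.exp (-τ) ≤ b) {s : ℂ}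
    (hs1 : 1 / 2 < s.re) (hs2 : s.re < 1) :
    ⟪(memLp_kFun hs1).toLp _, scalingUnitary τ g⟫_ℂ = cexp ((τ : ℂ) * (1 / 2 - s)) * rightMellin (g : ℝ → ℂ) s -
      (Real.exp (-τ / 2) : ℂ) * c / (1 - s) := by
  have h := rightMellin_eq_const_add_inner (scalingUnitary_ae_const_Ioo hc hτ) hs1 hs2
  rw [rightMellin_scalingUnitary] at h
  rw [eq_sub_iff_add_eq, add_comm, ← h]

/-- **`(ϑ(w)g)^(s) = Θ_w(s) ĝ(s)` on `1/2 < Re s < 1`** for `g ∈ L²` constant on `(0,b)` and a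
continuous weight supported in `{e^{−τ} ≤ b}`.
[cite: Burnol2004b, proof of Thm. 4.9 (arXiv:math/0203120v7 p. 11, TeX l.917–925: "G_ε(s) = θ(ε(s−1/2)+1/2)G(s)")] -/
theorem rightMellin_scalingOp {w : ℝ → ℂ} (hw : Continuous w) (hws : HasCompactSupport w) {b : ℝ}
    (hwb : ∀ τ, w τ ≠ 0 → Real.exp (-τ) ≤ b) {g : Lp ℂ 2 (volume : Measure ℝ)} {c : ℂ}
    (hc : ∀ᵐ x : ℝ, x ∈ Ioo 0 b → (g : ℝ → ℂ) x = c) {s : ℂ} (hs1 : 1 / 2 < s.re)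
    (hs2 : s.re < 1) :
    rightMellin (scalingOp w g : ℝ → ℂ) s =
      (∫ τ : ℝ, w τ * cexp ((τ : ℂ) * (1 / 2 - s))) * rightMellin (g : ℝ → ℂ) s := by
  have hwi : Integrable w := hw.integrable_of_hasCompactSupport hws
  have h0 := rightMellin_eq_const_add_inner (scalingOp_ae_const_Ioo hwi hwb hc) hs1 hs2
  rw [h0, scalingOp_apply hwi, ← integral_inner (integrable_smul_scalingUnitary hwi g)]
  have h1 : ∀ τ, ⟪(memLp_kFun hs1).toLp _, w τ • scalingUnitary τ g⟫_ℂ =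
      w τ * cexp ((τ : ℂ) * (1 / 2 - s)) * rightMellin (g : ℝ → ℂ) s -
        w τ * (Real.exp (-τ / 2) : ℂ) * (c / (1 - s)) := by
    intro τ
    by_cases hτ : w τ = 0
    · simp [hτ]
    · rw [inner_smul_right, inner_kLp_scalingUnitary hc (hwb τ hτ) hs1 hs2]
      ring
  simp_rw [h1]
  have hi1 : Integrable (fun τ : ℝ ↦ w τ * cexp ((τ : ℂ) * (1 / 2 - s)) * rightMellin (g : ℝ → ℂ) s) :=
    (integrable_mollMultiplier_integrand hw hws s).mul_const _
  have hi2 : Integrable (fun τ : ℝ ↦ w τ * (Real.exp (-τ / 2) : ℂ) * (c / (1 - s))) :=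
    ((hw.mul (by fun_prop)).integrable_of_hasCompactSupport hws.mul_right).mul_const _
  rw [integral_sub hi1 hi2, integral_mul_const, integral_mul_const]
  ring

/-! ## D. Polynomial bounds in strips from the L-Property; decay of `Θ_w · G` -/

/-- **From the L-Property to a polynomial bound on a whole strip away from the pole**: if `G` is
holomorphic off `s = 1` and has the L-Property, then on `a ≤ Re s ≤ b`, `|Im s| ≥ 1`,
`‖G(s)‖ ≤ C |Im s|^M` (the L-Property beyond its height `T₀`, compactness below it).
[cite: Burnol2004b, Def. of the L-Property and Thm. 4.8 (arXiv:math/0203120v7 p. 9, TeX l.822–834)] -/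
theorem exists_pow_bound_of_hasLProperty {G : ℂ → ℂ} (hG : HasLProperty G)
    (hGd : DifferentiableOn ℂ G {s | s ≠ 1}) (a b : ℝ) :
    ∃ (C : ℝ) (M : ℕ), 0 ≤ C ∧
      ∀ s : ℂ, a ≤ s.re → s.re ≤ b → 1 ≤ |s.im| → ‖G s‖ ≤ C * |s.im| ^ M := by
  rcases lt_or_ge b a with hab | hab
  · exact ⟨0, 0, le_rfl, fun s h1 h2 _ ↦ absurd (h1.trans h2) (not_le.2 hab)⟩
  obtain ⟨C₁, T₀, hC₁⟩ := hG a b 1 hab one_pos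
  set e : ℝ := max (1 / 2 - a) 0 + 1 with he
  set M : ℕ := ⌈e⌉₊ with hM
  set T₁ : ℝ := max T₀ 1 with hT₁
  set K : Set ℂ := {s | a ≤ s.re ∧ s.re ≤ b ∧ 1 ≤ |s.im| ∧ |s.im| ≤ T₁} with hK
  have hKc : IsCompact K := by
    refine Metric.isCompact_of_isClosed_isBounded ?_ ?_
    · have : K = (Complex.re ⁻¹' Icc a b) ∩ ((fun s : ℂ ↦ |s.im|) ⁻¹' Icc 1 T₁) := by
        ext s; simp [hK, mem_Icc, and_assoc]
      rw [this]
      exact (isClosed_Icc.preimage Complex.continuous_re).inter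
        (isClosed_Icc.preimage (continuous_abs.comp Complex.continuous_im))
    · refine isBounded_iff_forall_norm_le.2 ⟨|a| + |b| + T₁, fun s hs ↦ ?_⟩
      obtain ⟨h1, h2, -, h4⟩ := hs
      have hre : |s.re| ≤ |a| + |b| :=
        (abs_le_max_abs_abs h1 h2).trans (max_le (le_add_of_nonneg_right (abs_nonneg _))
          (le_add_of_nonneg_left (abs_nonneg _)))
      calc ‖s‖ ≤ |s.re| + |s.im| := Complex.norm_le_abs_re_add_abs_im s
        _ ≤ |a| + |b| + T₁ := add_le_add hre h4
  have hK1 : K ⊆ {s | s ≠ 1} := by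
    rintro s ⟨-, -, h3, -⟩ h
    rw [h] at h3
    norm_num at h3
  obtain ⟨C₂, hC₂⟩ := hKc.exists_bound_of_continuousOn (hGd.continuousOn.mono hK1)
  refine ⟨max C₂ 0 + max C₁ 0 * 2 ^ M, M, by positivity, fun s h1 h2 h3 ↦ ?_⟩
  have him : (1 : ℝ) ≤ |s.im| ^ M := one_le_pow₀ h3
  have hP : 0 ≤ |s.im| ^ M := pow_nonneg (abs_nonneg _) M
  rcases le_or_gt |s.im| T₁ with h4 | h4
  · have h5 := hC₂ s ⟨h1, h2, h3, h4⟩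
    calc ‖G s‖ ≤ max C₂ 0 := h5.trans (le_max_left _ _)
      _ ≤ max C₂ 0 * |s.im| ^ M := le_mul_of_one_le_right (le_max_right _ _) him
      _ ≤ (max C₂ 0 + max C₁ 0 * 2 ^ M) * |s.im| ^ M := by
          gcongr
          exact le_add_of_nonneg_right (by positivity)
  · have hT : T₀ ≤ |s.im| := (le_max_left _ _).trans h4.le
    have h5 := hC₁ s.re s.im h1 h2 hT
    rw [Complex.re_add_im] at h5
    have h6 : (1 + |s.im|) ^ e ≤ (2 : ℝ) ^ M * |s.im| ^ M := by
      calc (1 + |s.im|) ^ e ≤ (1 + |s.im|) ^ (M : ℝ) :=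
            Real.rpow_le_rpow_of_exponent_le (by linarith [abs_nonneg s.im]) (Nat.le_ceil e)
        _ = (1 + |s.im|) ^ M := Real.rpow_natCast _ _
        _ ≤ (2 * |s.im|) ^ M := pow_le_pow_left₀ (by positivity) (by linarith) M
        _ = 2 ^ M * |s.im| ^ M := mul_pow _ _ _
    have he0 : 0 ≤ (1 + |s.im|) ^ e := Real.rpow_nonneg (by positivity) _
    calc ‖G s‖ ≤ C₁ * (1 + |s.im|) ^ e := h5
      _ ≤ max C₁ 0 * (1 + |s.im|) ^ e := mul_le_mul_of_nonneg_right (le_max_left _ _) he0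
      _ ≤ max C₁ 0 * (2 ^ M * |s.im| ^ M) := mul_le_mul_of_nonneg_left h6 (le_max_right _ _)
      _ = (max C₁ 0 * 2 ^ M) * |s.im| ^ M := by ring
      _ ≤ (max C₂ 0 + max C₁ 0 * 2 ^ M) * |s.im| ^ M := by
          gcongr
          exact le_add_of_nonneg_left (le_max_right _ _)

/-- **Quick decrease of `Θ_w · G` in vertical strips**: for a smooth compactly supported weight and a
function `G` holomorphic off `1` with the L-Property, `Θ_w(s)G(s) = O(|s|^{−N})` on every strip
`a ≤ Re s ≤ b`, `|Im s| ≥ 1`, for every `N` ("their quick decrease in vertical strips is guaranteed by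
the fact that `G(s)` has the L-Property"). [cite: Burnol2004b, proof of Thm. 4.9 (arXiv:math/0203120v7 p. 11, TeX l.921–923)] -/
theorem exists_decay_mollMultiplier_mul {w : ℝ → ℂ} (hw : ContDiff ℝ (⊤ : ℕ∞) w)
    (hws : HasCompactSupport w) {G : ℂ → ℂ} (hG : HasLProperty G)
    (hGd : DifferentiableOn ℂ G {s | s ≠ 1}) (a b : ℝ) (N : ℕ) :
    ∃ C : ℝ, ∀ s : ℂ, a ≤ s.re → s.re ≤ b → 1 ≤ |s.im| →
      ‖(∫ τ : ℝ, w τ * cexp ((τ : ℂ) * (1 / 2 - s))) * G s‖ ≤ C * ‖s‖ ^ (-(N : ℝ)) := by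
  obtain ⟨R, hR0, hR⟩ := exists_tsupport_subset_Icc hws
  obtain ⟨C, M, hC0, hC⟩ := exists_pow_bound_of_hasLProperty hG hGd a b
  set D : ℝ := Real.exp (R * (1 / 2 + (|a| + |b|))) * ∫ τ : ℝ, ‖deriv^[N + M] w τ‖ with hD
  set A : ℝ := |a| + |b| + 1 with hA
  have hD0 : 0 ≤ D := mul_nonneg (Real.exp_pos _).le (integral_nonneg fun _ ↦ norm_nonneg _)
  have hA0 : 0 < A := by positivity
  refine ⟨D * C * A ^ N, fun s h1 h2 h3 ↦ ?_⟩
  have him0 : 0 < |s.im| := one_pos.trans_le h3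
  have hs0 : s.im ≠ 0 := abs_pos.1 him0
  have hre : |s.re| ≤ |a| + |b| :=
    (abs_le_max_abs_abs h1 h2).trans (max_le (le_add_of_nonneg_right (abs_nonneg _))
      (le_add_of_nonneg_left (abs_nonneg _)))
  have hexp : Real.exp (R * |1 / 2 - s.re|) ≤ Real.exp (R * (1 / 2 + (|a| + |b|))) := by
    apply Real.exp_le_exp.2
    apply mul_le_mul_of_nonneg_left _ hR0
    calc |1 / 2 - s.re| ≤ |(1 / 2 : ℝ)| + |s.re| := abs_sub _ _
      _ ≤ 1 / 2 + (|a| + |b|) := by rw [abs_of_pos (by norm_num : (0 : ℝ) < 1 / 2)]; gcongr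
  have hΘ : ‖∫ τ : ℝ, w τ * cexp ((τ : ℂ) * (1 / 2 - s))‖ ≤ D * |s.im|⁻¹ ^ (N + M) := by
    refine (norm_mollMultiplier_le_pow hw hws hR (N + M) hs0).trans ?_
    rw [hD]
    gcongr
  have hsA : ‖s‖ ≤ A * |s.im| := by
    calc ‖s‖ ≤ |s.re| + |s.im| := Complex.norm_le_abs_re_add_abs_im s
      _ ≤ (|a| + |b|) * |s.im| + 1 * |s.im| := by
          gcongr
          · exact hre.trans (le_mul_of_one_le_right (by positivity) h3)
          · rw [one_mul]
      _ = A * |s.im| := by rw [hA]; ring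
  have hs_pos : 0 < ‖s‖ := by
    refine norm_pos_iff.2 fun h ↦ hs0 ?_
    rw [h]; simp
  have hinv : |s.im|⁻¹ ≤ A * ‖s‖⁻¹ := by
    rw [inv_le_iff_one_le_mul₀ him0]
    calc (1 : ℝ) = A * ‖s‖⁻¹ * (‖s‖ / A) := by field_simp
      _ ≤ A * ‖s‖⁻¹ * |s.im| := by
          gcongr
          rwa [div_le_iff₀ hA0, mul_comm]
  calc ‖(∫ τ : ℝ, w τ * cexp ((τ : ℂ) * (1 / 2 - s))) * G s‖
        = ‖∫ τ : ℝ, w τ * cexp ((τ : ℂ) * (1 / 2 - s))‖ * ‖G s‖ := norm_mul _ _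
    _ ≤ (D * |s.im|⁻¹ ^ (N + M)) * (C * |s.im| ^ M) :=
        mul_le_mul hΘ (hC s h1 h2 h3) (norm_nonneg _) (by positivity)
    _ = D * C * |s.im|⁻¹ ^ N := by
        rw [pow_add, inv_pow, inv_pow]
        field_simp
    _ ≤ D * C * (A * ‖s‖⁻¹) ^ N := by gcongr
    _ = D * C * A ^ N * ‖s‖ ^ (-(N : ℝ)) := by
        rw [mul_pow, Real.rpow_neg (norm_nonneg _), Real.rpow_natCast, inv_pow]
        ring

/-! ## E. `ϑ(ψ)g ∈ 𝓛₁` for `g ∈ L_b` (`b > 1`, `supp ψ ⊆ [−log b, log b]`), and Theorem 4.9 -/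

/-- For `|τ| ≤ log b`: `e^{−τ} ≤ b`. [folklore] -/
private theorem exp_neg_le_of_abs_le_log {b τ : ℝ} (hb : 1 < b) (hτ : |τ| ≤ Real.log b) :
    Real.exp (-τ) ≤ b := by
  calc Real.exp (-τ) ≤ Real.exp (Real.log b) := Real.exp_le_exp.2 ((neg_le_abs τ).trans hτ)
    _ = b := Real.exp_log (one_pos.trans hb)

/-- **`ϑ(w)g ∈ L_1`** for `g ∈ L_b`, `b > 1`, and a continuous weight supported in `[−log b, log b]`:
evenness, constancy on `(0,1)` of the mollifier, and of its Fourier transform `𝓕(ϑ(w)g) = ϑ(w(−·))𝓕g`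
(`𝓕g` is constant on `(0,b)` too). This replaces, by a direct function-side argument, the printed appeal
to the `ℍ²` characterisation of `L̂_1` (Prop. 4.1), whose typed form is refuted in the tree
(`Burnol2004b_prop4_1_false`); the content — "the support of this multiplicative convolution will be
included in `[1,∞)` if `1 ≤ exp(−ε)b`", for the function AND for its cosine transform — is the same.
[cite: Burnol2004b, proof of Thm. 4.9 (arXiv:math/0203120v7 p. 11, TeX l.923–940)] -/
theorem scalingOp_mem_sonineL_one {w : ℝ → ℂ} (hw : Continuous w) (hws : HasCompactSupport w)
    {b : ℝ} (hb : 1 < b) (hwb : ∀ τ, w τ ≠ 0 → |τ| ≤ Real.log b)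
    {g : Lp ℂ 2 (volume : Measure ℝ)} (hg : g ∈ sonineL b) : scalingOp w g ∈ sonineL 1 := by
  have hwi : Integrable w := hw.integrable_of_hasCompactSupport hws
  obtain ⟨heven, ⟨c, hc⟩, ⟨c', hc'⟩⟩ := hg
  refine ⟨scalingOp_mem_evenPart hwi heven, ⟨_, scalingOp_ae_const_Ioo hwi
    (fun τ hτ ↦ exp_neg_le_of_abs_le_log hb (hwb τ hτ)) hc⟩,
    ⟨c' * ∫ τ : ℝ, w (-τ) * (Real.exp (-τ / 2) : ℂ), ?_⟩⟩
  rw [fourier_scalingOp hwi]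
  exact scalingOp_ae_const_Ioo hwi.comp_neg
    (fun τ hτ ↦ exp_neg_le_of_abs_le_log hb (by simpa using hwb (-τ) hτ)) hc'

/-- **`ϑ(w)g ∈ 𝓛₁`** for `g ∈ L_b`, `b > 1`, and a SMOOTH weight supported in `[−log b, log b]`: the
continued transform of `ϑ(w)g` is `Θ_w · G_g` off `s = 1` (uniqueness of the continuation), and
`Θ_w · G_g` has quick decrease in every vertical strip by Thm. 4.8 (`Burnol2004b_thm4_8_holds`) and
the rapid decay of `Θ_w`. [cite: Burnol2004b, proof of Thm. 4.9 (arXiv:math/0203120v7 p. 11, TeX l.917–940)] -/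
theorem scalingOp_mem_burnolScriptL1 {w : ℝ → ℂ} (hw : ContDiff ℝ (⊤ : ℕ∞) w)
    (hws : HasCompactSupport w) {b : ℝ} (hb : 1 < b) (hwb : ∀ τ, w τ ≠ 0 → |τ| ≤ Real.log b)
    {g : Lp ℂ 2 (volume : Measure ℝ)} (hg : g ∈ sonineL b) : scalingOp w g ∈ burnolScriptL1 := by
  have hwc : Continuous w := hw.continuous
  have hb0 : 0 < b := one_pos.trans hb
  have hexp : ∀ τ, w τ ≠ 0 → Real.exp (-τ) ≤ b := fun τ hτ ↦
    exp_neg_le_of_abs_le_log hb (hwb τ hτ)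
  refine ⟨scalingOp_mem_sonineL_one hwc hws hb hwb hg, fun a b' N ↦ ?_⟩
  have hG : HasRightMellinContinuation (g : ℝ → ℂ) (rightMellinExt (g : ℝ → ℂ)) :=
    hasRightMellinContinuation_rightMellinExt_of_mem_sonineL hb0 hg
  have hL : HasLProperty (rightMellinExt (g : ℝ → ℂ)) := Burnol2004b_thm4_8_holds b hb0 g hg
  obtain ⟨-, ⟨c, hc⟩, -⟩ := hg
  set G' : ℂ → ℂ := fun s ↦ (∫ τ : ℝ, w τ * cexp ((τ : ℂ) * (1 / 2 - s))) *
    rightMellinExt (g : ℝ → ℂ) s with hG'def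
  have hG' : HasRightMellinContinuation (scalingOp w g : ℝ → ℂ) G' := by
    refine ⟨(differentiable_mollMultiplier hwc hws).differentiableOn.mul hG.1, fun s hs1 hs2 ↦ ?_⟩
    rw [hG'def]
    dsimp only
    rw [hG.2 s hs1 hs2, rightMellin_scalingOp hwc hws hexp hc hs1 hs2]
  have hEq : Set.EqOn (rightMellinExt (scalingOp w g : ℝ → ℂ)) G' {s | s ≠ 1} :=
    (hasRightMellinContinuation_rightMellinExt ⟨G', hG'⟩).eqOn hG'
  obtain ⟨C, hC⟩ := exists_decay_mollMultiplier_mul hw hws hL hG.1 a b' N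
  refine ⟨C, fun s h1 h2 h3 ↦ ?_⟩
  have hs1 : s ≠ 1 := by
    intro h; rw [h] at h3; norm_num at h3
  rw [hEq hs1]
  exact hC s h1 h2 h3

end BurnolScriptL1Density

open Literature.NumberTheory.ConnesConsani2021 (scalingUnitary scalingOp scalingUnitary_zero
  continuous_scalingUnitary_apply) in
open BurnolScriptL1Density in
/-- **Burnol 2004b, Thm. 4.9 — DISCHARGE of the named fact `Burnol2004b_thm4_9`: "The sub-vector
space `𝓛₁` is dense in `L_1`."** Printed proof (TeX l.908–944) followed step for step: by Prop. 4.6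
(`Burnol2004b_prop4_6_holds`) it suffices to approximate `g ∈ L_b`, `b > 1`; the multiplicative
mollifications `ϑ(ψ_ε)g`, `ψ_ε` a smooth bump of mass one supported in `[−ε, ε]`,
`ε ≤ log b` (Burnol's `G_ε = θ(ε(s−1/2)+1/2)G`), lie in `𝓛₁` (`scalingOp_mem_burnolScriptL1`: support
bookkeeping on the function side and on the Fourier side; quick decrease from Thm. 4.8 =
`Burnol2004b_thm4_8_holds` and the rapid decay of `θ`), and converge to `g` in `L²` as `ε → 0` (strong
continuity of the unitary scaling group). RH-FREE; bears_on B-C/B-P (COLUMN 6 DBR); nothing here bears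
on the truth of RH. [cite: Burnol2004b, Thm. 4.9 (arXiv:math/0203120v7 p. 11, TeX l.908–944)] -/
theorem Burnol2004b_thm4_9_holds : Burnol2004b_thm4_9 := by
  intro g hg
  have h46 := (Burnol2004b_prop4_6_holds 1 one_pos).2 hg
  suffices hsub : (⋃ b ∈ Set.Ioi (1 : ℝ), sonineL b) ⊆ closure burnolScriptL1 from
    closure_minimal hsub isClosed_closure h46
  intro h hh
  simp only [mem_iUnion] at hh
  obtain ⟨b, hb, hh⟩ := hh
  rw [mem_Ioi] at hb
  rw [Metric.mem_closure_iff]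
  intro δ hδ
  -- strong continuity of `τ ↦ ϑ(e^τ)h` at `τ = 0`
  have hcont := (continuous_scalingUnitary_apply h).tendsto 0
  have h0 : scalingUnitary 0 h = h := by rw [scalingUnitary_zero]; rfl
  rw [h0] at hcont
  obtain ⟨η, hη, hηδ⟩ := Metric.tendsto_nhds_nhds.1 hcont (δ / 2) (half_pos hδ)
  -- the bump `ψ_ε`, `ε = min(η/2, log b)`
  set ε : ℝ := min (η / 2) (Real.log b) with hεdef
  have hε : 0 < ε := lt_min (half_pos hη) (Real.log_pos hb)
  let ψ : ContDiffBump (0 : ℝ) := ⟨ε / 2, ε, half_pos hε, half_lt_self hε⟩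
  set w : ℝ → ℂ := fun τ ↦ ((ψ.normed volume τ : ℝ) : ℂ) with hwdef
  have hw : ContDiff ℝ (⊤ : ℕ∞) w := by
    have := Complex.ofRealCLM.contDiff.comp (ψ.contDiff_normed (μ := volume) (n := (⊤ : ℕ∞)))
    simpa [hwdef, Function.comp_def] using this
  have hws : HasCompactSupport w := by
    have := ψ.hasCompactSupport_normed (μ := volume).comp_left (g := ((↑) : ℝ → ℂ))
      Complex.ofReal_zero
    simpa [hwdef, Function.comp_def] using this
  have hwsupp : ∀ τ, w τ ≠ 0 → |τ| < ε := by
    intro τ hτ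
    have hτ' : τ ∈ Function.support (ψ.normed volume) := by
      simpa [hwdef, Function.mem_support] using hτ
    rw [ψ.support_normed_eq] at hτ'
    simpa [Metric.mem_ball, Real.dist_eq] using hτ'
  have hwb : ∀ τ, w τ ≠ 0 → |τ| ≤ Real.log b := fun τ hτ ↦
    (hwsupp τ hτ).le.trans (min_le_right _ _)
  refine ⟨scalingOp w h, scalingOp_mem_burnolScriptL1 hw hws hb hwb hh, ?_⟩
  rw [dist_comm, dist_eq_norm]
  have hwi : Integrable w := hw.continuous.integrable_of_hasCompactSupport hws
  have hw1 : ∫ τ, w τ = 1 := by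
    show ∫ τ, ((ψ.normed volume τ : ℝ) : ℂ) = 1
    rw [integral_complex_ofReal, ψ.integral_normed, Complex.ofReal_one]
  have hnorm1 : ∫ τ, ‖w τ‖ = 1 := by
    have : (fun τ ↦ ‖w τ‖) = ψ.normed volume := by
      funext τ
      rw [hwdef]
      dsimp only
      rw [Complex.norm_real, Real.norm_eq_abs, abs_of_nonneg (ψ.nonneg_normed τ)]
    rw [this, ψ.integral_normed]
  have key := norm_scalingOp_sub_le hwi hw1 h (half_pos hδ).le (fun τ hτ ↦ ?_)
  · calc ‖scalingOp w h - h‖ ≤ δ / 2 * ∫ τ, ‖w τ‖ := key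
      _ = δ / 2 := by rw [hnorm1, mul_one]
      _ < δ := half_lt_self hδ
  · have h1 : |τ| < η := by
      calc |τ| < ε := hwsupp τ hτ
        _ ≤ η / 2 := min_le_left _ _
        _ < η := half_lt_self hη
    have := hηδ (show dist τ 0 < η by simpa using h1)
    rw [dist_eq_norm] at this
    exact this.le


end Literature.NumberTheory.LFunctions
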